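import Summits.CriticalPhenomena.PercolationContinuityZ3.Theses.PercNearOneGluing
import Literature.Probability.Percolation.PercolationProofs
import Literature.Probability.Percolation.ConditionalPositiveAssociationProofs
import Literature.Probability.Percolation.TwoClusterConditionalAssociationProofs
import Summits.CriticalPhenomena.PercolationContinuityZ3.Theorems.PercNearOneGluingAdditiveGluingGoodBase
import Summits.CriticalPhenomena.PercolationContinuityZ3.Theorems.PercNearOneGluingAdditiveGluingLemma5AnyRelay
import Literature.Probability.LatticeModels.ProdBernoulliAtomExpansion
import Literature.Probability.Percolation.OpenGraphCuts

/-! TTRL-lite variant V146 of stmt-CriticalPhenomena-4576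

**Verdict: DISPROVED.**  V146 drops hypothesis 4, `∀ W, sel W ∈ A` (the selected relay of a dead
pocket lies in the relay set), from the good-step inequality (`stub_goodStep` of the crux
`PercNearOneGluing.AdditiveGluing`).  Without it one may select the observer itself, `sel ≡ o`:
since `o ∈ W` for every pocket `W` in the sum, `o ∉ Wᶜ`, so `{sel W ↔ b in Wᶜ} = ∅` and every
summand carries the factor `P(∅ᶜ) = 1`; the sum becomes `P(C(o) ∩ A = ∅)`, which need not be
small.  Witness: `n = 3`, `o = 0`, `y = 1`, `b = 2`, `A = {2}`, `w = 𝟙_{s(0,1)}`, `t = 0`,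
`sel ≡ 0`.  The relay hypothesis `1 - 0 ≤ μ(2 ↔ 2) = 1` holds, the configuration is a.s. equal to
`{s(0,1)}` (product formula `prodBernoulli_real_setOf_forall_iff` over all six pairs), on which
`C(0) = {0,1}`, so the summand at `W = {0,1}` equals `1 · 1`, and `LHS ≥ 1 > 0 = t`.  The displayed
induction hypothesis is discharged, exactly as for V124, by the isolated-observer base case
`stub_goodBase stub_lemma5AnyRelay` (Kozma–Nitzan Thm 4): a weighting `w'` with fewer
positive-degree vertices than `w` (which has two, `0` and `1`) has at most one, hence every
non-loop pair of `w'` has weight `0`.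
-/

namespace Summit.CriticalPhenomena.PercolationContinuityZ3.Theorems

open MeasureTheory Literature.Probability.LatticeModels Literature.Probability.Percolation
open scoped Classical BigOperators

/-- **TTRL-lite variant V146 (hypothesis `∀ W, sel W ∈ A` dropped) of the good-step inequality of
stmt-CriticalPhenomena-4576 is false.**  Counterexample: `n = 3`, `o = 0`, `b = 2`, `A = {2}`,
`w = 𝟙_{s(0,1)}`, `t = 0`, `sel ≡ 0` (the observer itself, which the dropped hypothesis forbade);
the induction hypothesis holds by the isolated-observer base case
(`stub_goodBase stub_lemma5AnyRelay`), the relay hypothesis reads `1 - 0 ≤ μ(2 ↔ 2) = 1`, every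
summand factor `μ({0 ↔ 2 in Wᶜ}ᶜ)` is `1` because `0 ∈ W`, and the summand at `W = {0,1}` is
`μ(C(0) = {0,1}) = 1`, so the left-hand side is `≥ 1 > 0 = t`. [this project] -/
theorem cp4576_goodstep_var146_false : ¬ (∀ (n : ℕ) (w : Sym2 (Fin n) → unitInterval) (A : Finset (Fin n)) (o b : Fin n), b ∈ A → o ∉ A → (∃ y : Fin n, y ∉ A ∧ y ≠ o ∧ (w s(o, y) : ℝ) ≠ 0) → (∀ w' : Sym2 (Fin n) → unitInterval, (Finset.univ.filter (fun v : Fin n => ∃ u : Fin n, 0 < (w' s(u, v) : ℝ))).card < (Finset.univ.filter (fun v : Fin n => ∃ u : Fin n, 0 < (w s(u, v) : ℝ))).card → ∀ (A' : Finset (Fin n)) (o' b' : Fin n), b' ∈ A' → o' ∉ A' → ∀ (t : ℝ) (sel : Finset (Fin n) → Fin n), (∀ W, sel W ∈ A') → (∀ a ∈ A', 1 - t ≤ (prodBernoulli w').real (openConn a b')) → (prodBernoulli w').real ((⋃ a ∈ A', openConn o' a) ∩ (openConn o' b')ᶜ) + ∑ W ∈ (Finset.univ : Finset (Finset (Fin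 n))).filter (fun W => o' ∈ W ∧ Disjoint W A'), (prodBernoulli w').real {ω : BondConfig (Fin n) | openCluster ω o' = (W : Set (Fin n))} * (prodBernoulli w').real (openConnIn ((W : Set (Fin n))ᶜ) (sel W) b')ᶜ ≤ t) → ∀ (t : ℝ) (sel : Finset (Fin n) → Fin n), (∀ a ∈ A, 1 - t ≤ (prodBernoulli w).real (openConn a b)) → (prodBernoulli w).real ((⋃ a ∈ A, openConn o a) ∩ (openConn o b)ᶜ) + ∑ W ∈ (Finset.univ : Finset (Finset (Fin n))).filter (fun W => o ∈ W ∧ Disjoint W A), (prodBernoulli w).real {ω : BondConfig (Fin n) | openCluster ω o = (W : Set (Fin n))} * (prodBernoulli w).real (openConnIn ((W : Set (Fin n))ᶜ) (sel W) b)ᶜ ≤ t) := by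
  intro h
  -- the witness weighting: the single charged pair `s(0, 1)` on `Fin 3`
  set w : Sym2 (Fin 3) → unitInterval := fun e => if e = s(0, 1) then 1 else 0 with hw
  have hw01 : (w s(0, 1) : ℝ) = 1 := by simp [hw]
  have hA : (2 : Fin 3) ∈ ({2} : Finset (Fin 3)) := Finset.mem_singleton_self _
  have hoA : (0 : Fin 3) ∉ ({2} : Finset (Fin 3)) := by decide
  have hy : ∃ y : Fin 3, y ∉ ({2} : Finset (Fin 3)) ∧ y ≠ 0 ∧ (w s(0, y) : ℝ) ≠ 0 :=
    ⟨1, by decide, by decide, by rw [hw01]; exact one_ne_zero⟩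
  -- `w` has at most two positive-degree vertices (`0` and `1`)
  have hcardw : (Finset.univ.filter (fun v : Fin 3 => ∃ u : Fin 3, 0 < (w s(u, v) : ℝ))).card ≤ 2 := by
    have hsub : Finset.univ.filter (fun v : Fin 3 => ∃ u : Fin 3, 0 < (w s(u, v) : ℝ)) ⊆ {0, 1} := by
      intro v hv
      obtain ⟨u, hu⟩ := (Finset.mem_filter.1 hv).2
      have he : s(u, v) = s(0, 1) := by
        by_contra hne
        simp [hw, hne] at hu
      have key : ∀ u v : Fin 3, s(u, v) = s(0, 1) → v = 0 ∨ v = 1 := by decide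
      rcases key u v he with rfl | rfl <;> simp
    exact (Finset.card_le_card hsub).trans (by decide)
  -- the induction hypothesis: isolated-observer base case (KN Thm 4 via Lemma 5)
  have hIH : ∀ w' : Sym2 (Fin 3) → unitInterval,
      (Finset.univ.filter (fun v : Fin 3 => ∃ u : Fin 3, 0 < (w' s(u, v) : ℝ))).card <
        (Finset.univ.filter (fun v : Fin 3 => ∃ u : Fin 3, 0 < (w s(u, v) : ℝ))).card →
      ∀ (A' : Finset (Fin 3)) (o' b' : Fin 3), b' ∈ A' → o' ∉ A' →
        ∀ (t : ℝ) (sel : Finset (Fin 3) → Fin 3), (∀ W, sel W ∈ A') →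
          (∀ a ∈ A', 1 - t ≤ (prodBernoulli w').real (openConn a b')) →
          (prodBernoulli w').real ((⋃ a ∈ A', openConn o' a) ∩ (openConn o' b')ᶜ) +
            ∑ W ∈ (Finset.univ : Finset (Finset (Fin 3))).filter (fun W => o' ∈ W ∧ Disjoint W A'),
              (prodBernoulli w').real {ω : BondConfig (Fin 3) | openCluster ω o' = (W : Set (Fin 3))} *
                (prodBernoulli w').real (openConnIn ((W : Set (Fin 3))ᶜ) (sel W) b')ᶜ ≤ t := by
    intro w' hlt A' o' b' hb' ho' t sel hsel hrel
    refine stub_goodBase stub_lemma5AnyRelay 3 w' A' o' b' hb' ho' ?_ t sel hsel hrel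
    intro y _ hyo
    by_contra hne
    have hpos : 0 < (w' s(o', y) : ℝ) := lt_of_le_of_ne (w' s(o', y)).2.1 (Ne.symm hne)
    have hy' : y ∈ Finset.univ.filter (fun v : Fin 3 => ∃ u : Fin 3, 0 < (w' s(u, v) : ℝ)) :=
      Finset.mem_filter.2 ⟨Finset.mem_univ _, o', hpos⟩
    have ho'' : o' ∈ Finset.univ.filter (fun v : Fin 3 => ∃ u : Fin 3, 0 < (w' s(u, v) : ℝ)) :=
      Finset.mem_filter.2 ⟨Finset.mem_univ _, y, by rw [Sym2.eq_swap]; exact hpos⟩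
    have h2 : 2 ≤ (Finset.univ.filter (fun v : Fin 3 => ∃ u : Fin 3, 0 < (w' s(u, v) : ℝ))).card := by
      have hsub : ({o', y} : Finset (Fin 3)) ⊆
          Finset.univ.filter (fun v : Fin 3 => ∃ u : Fin 3, 0 < (w' s(u, v) : ℝ)) := by
        intro v hv
        rcases Finset.mem_insert.1 hv with rfl | hv
        · exact ho''
        · rw [Finset.mem_singleton.1 hv]; exact hy'
      have hc : ({o', y} : Finset (Fin 3)).card = 2 := Finset.card_pair (Ne.symm hyo)
      exact hc.symm.trans_le (Finset.card_le_card hsub)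
    exact absurd (lt_of_lt_of_le hlt hcardw) (not_lt.2 h2)
  -- the relay hypothesis at level `t = 0`: `μ(2 ↔ 2) = 1`
  have hrel : ∀ a ∈ ({2} : Finset (Fin 3)), 1 - (0 : ℝ) ≤ (prodBernoulli w).real (openConn a 2) := by
    intro a ha
    rw [Finset.mem_singleton.1 ha]
    have huniv : (openConn 2 2 : Set (BondConfig (Fin 3))) = Set.univ := by
      ext ω
      simp only [Set.mem_univ, iff_true]
      exact SimpleGraph.Reachable.refl _
    rw [huniv, probReal_univ]
    norm_num
  -- select the observer itself: `sel ≡ 0`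
  have key := h 3 w {2} 0 2 hA hoA hy hIH 0 (fun _ => 0) hrel
  -- the pocket `W = {0, 1}` occurs in the sum
  have hWmem : ({0, 1} : Finset (Fin 3)) ∈
      (Finset.univ : Finset (Finset (Fin 3))).filter (fun W => (0 : Fin 3) ∈ W ∧ Disjoint W {2}) := by
    refine Finset.mem_filter.2 ⟨Finset.mem_univ _, by simp, ?_⟩
    rw [Finset.disjoint_singleton_right]
    decide
  -- its second factor is `μ(∅ᶜ) = 1`, as `0 ∉ {0,1}ᶜ`
  have hfac : (prodBernoulli w).real
      (openConnIn (((({0, 1} : Finset (Fin 3)) : Set (Fin 3)))ᶜ) ((fun _ : Finset (Fin 3) => (0 : Fin 3)) {0, 1}) 2)ᶜ = 1 := by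
    have hempty : (openConnIn (((({0, 1} : Finset (Fin 3)) : Set (Fin 3)))ᶜ) (0 : Fin 3) 2 :
        Set (BondConfig (Fin 3))) = ∅ := by
      ext ω
      simp only [openConnIn, Set.mem_setOf_eq, Set.mem_empty_iff_false, iff_false]
      rintro ⟨hx, -, -⟩
      exact hx (by simp)
    show (prodBernoulli w).real (openConnIn (((({0, 1} : Finset (Fin 3)) : Set (Fin 3)))ᶜ) (0 : Fin 3) 2)ᶜ = 1
    rw [hempty, Set.compl_empty, probReal_univ]
  -- its first factor is `μ(C(0) = {0,1}) = 1`: the configuration is a.s. `{s(0,1)}`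
  have hatom : (prodBernoulli w).real
      {ω : BondConfig (Fin 3) | ∀ i ∈ (Finset.univ : Finset (Sym2 (Fin 3))), (i ∈ ω ↔ i = s(0, 1))} = 1 := by
    rw [prodBernoulli_real_setOf_forall_iff w Finset.univ (fun i => i = s(0, 1))]
    refine Finset.prod_eq_one fun i _ => ?_
    by_cases hi : i = s(0, 1)
    · rw [if_pos hi, hi, hw01]
    · rw [if_neg hi]
      have : (w i : ℝ) = 0 := by simp [hw, hi]
      rw [this]; norm_num
  have hsubset : {ω : BondConfig (Fin 3) | ∀ i ∈ (Finset.univ : Finset (Sym2 (Fin 3))), (i ∈ ω ↔ i = s(0, 1))} ⊆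
      {ω : BondConfig (Fin 3) | openCluster ω 0 = ((({0, 1} : Finset (Fin 3)) : Set (Fin 3)))} := by
    intro ω hω
    simp only [Set.mem_setOf_eq] at hω
    have hω' : ∀ i : Sym2 (Fin 3), i ∈ ω ↔ i = s(0, 1) := fun i => hω i (Finset.mem_univ _)
    have h01 : s((0 : Fin 3), 1) ∈ ω := (hω' _).2 rfl
    have hkey2 : ∀ v : Fin 3, v ≠ 2 → s((2 : Fin 3), v) ≠ s(0, 1) := by decide
    have hno2 : ∀ v : Fin 3, v ≠ 2 → s((2 : Fin 3), v) ∉ ω := fun v hv hmem =>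
      hkey2 v hv ((hω' _).1 hmem)
    ext y
    simp only [openCluster, Set.mem_setOf_eq, Finset.coe_insert, Finset.coe_singleton,
      Set.mem_insert_iff, Set.mem_singleton_iff]
    constructor
    · intro hr
      by_contra hc
      obtain ⟨h0, h1⟩ := not_or.1 hc
      have hkey : ∀ y : Fin 3, y ≠ 0 → y ≠ 1 → y = 2 := by decide
      have hy2 : y = 2 := hkey y h0 h1
      subst hy2
      exact not_reachable_openGraph_of_forall_notMem ω (x := 2) (y := 0) (by decide) hno2 hr.symm
    · rintro (rfl | rfl)
      · exact SimpleGraph.Reachable.refl _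
      · exact reachable_openGraph_of_mem ω h01 (by decide)
  have hclu : 1 ≤ (prodBernoulli w).real
      {ω : BondConfig (Fin 3) | openCluster ω 0 = ((({0, 1} : Finset (Fin 3)) : Set (Fin 3)))} := by
    rw [← hatom]
    exact measureReal_mono hsubset
  -- hence the summand at `W = {0,1}` is at least `1`, and so is the whole (non-negative) sum
  have hsum : (1 : ℝ) ≤ ∑ W ∈ (Finset.univ : Finset (Finset (Fin 3))).filter
      (fun W => (0 : Fin 3) ∈ W ∧ Disjoint W {2}),
        (prodBernoulli w).real {ω : BondConfig (Fin 3) | openCluster ω 0 = (W : Set (Fin 3))} *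
          (prodBernoulli w).real (openConnIn ((W : Set (Fin 3))ᶜ) ((fun _ : Finset (Fin 3) => (0 : Fin 3)) W) 2)ᶜ := by
    refine le_trans ?_ (Finset.single_le_sum
      (fun W _ => mul_nonneg measureReal_nonneg measureReal_nonneg) hWmem)
    rw [hfac, mul_one]
    exact hclu
  have hnn : 0 ≤ (prodBernoulli w).real
      ((⋃ a ∈ ({2} : Finset (Fin 3)), openConn (0 : Fin 3) a) ∩ (openConn (0 : Fin 3) 2)ᶜ) :=
    measureReal_nonneg
  linarith

end Summit.CriticalPhenomena.PercolationContinuityZ3.Theorems
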